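import Mathlib.RingTheory.Polynomial.GaussLemma
import Mathlib.FieldTheory.KummerPolynomial
import Mathlib.RingTheory.DiscreteValuationRing.TFAE
import Mathlib.Algebra.MvPolynomial.NoZeroDivisors
import Mathlib.RingTheory.MvPolynomial.Basic
import Mathlib.RingTheory.Polynomial.UniqueFactorization
import Mathlib.RingTheory.AdjoinRoot
import Mathlib.RingTheory.Localization.Submodule
import HarnessLib

/-!
# [OURS · L1 W8.2] The twist-exponent witness `y^q = (x^p − t)^N`, I: the curves and their cusp point

Cell `res-hironaka` (run/shared/lean/pub/res-hironaka/), LADDER-RESOLUTION rung L (RESCUE), slot W8.2 of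
plan/RESCUE-SEED.md («PRIME-FIELD / UNIVERSALITY TRANSFER instead of descent»), door 2 = route
`UniformComplexity`, host item `PrimeModelTransfer` (stmt-ResolutionOfSingularities-8933); prover
res-L1-s82-pv-2 (gen 3). THESES-FREE module (Mathlib + `HarnessLib` only).

[OURS · L1 W8.2] NEGATIVE-SIDE INFRASTRUCTURE for the Frobenius-twist normal form of the W8.2 residual
(`CampaignW82.HasSmoothFrobeniusTwistModel p K f₀ = ∃ e, …`, p483512): the commutative algebra of the affine
plane curves `C_N : y^q = (x^p − t)^N` over a field `K` of characteristic `p` (`q` prime, `q ≠ p`, `q ∤ N`),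
which for `N = p^e` is the `e`-th Frobenius twist of `y^q = x^{p^{e+1}} − t` and for `N = 1` is Kollár's
regular non-smooth curve `y^q = x^p − t` (Kollár 2007, 1.19; the barrier file
`Literature/Barriers/ResolutionOfSingularities/RegularNotGeometricallyRegular.lean` treats `N = 1` over
`𝔽_p(t)`). Used by `…TwistExponentNormalization` / `…TwistExponentRigidity` towards the rung «the exponent `e`
of the Frobenius-twist normal form cannot be bounded in terms of `(p, n)`, already for `n = 1`».

## Content (all proved; `X₀ = y`, `X₁ = x` in `MvPolynomial (Fin 2) K`)

* §0 `prime_X_pow_sub_C`, `forall_pow_ne_of_not_dvd_totalDegree`: over a UFD, `Y^q − a` is prime when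
  `a` is not a `q`-th power in the fraction field (Gauss + Kummer, Mathlib), e.g. when `q ∤ deg a`.
* §1 `twistPoly K p t q N = X₀^q − (X₁^p − C t)^N`, `TwistRing K p t q N = K[X₀,X₁]/(f_N)`;
  `prime_twistPoly`, `isDomain_twistRing` (`q ≠ p` prime, `q ∤ N`).
* §2 `pointHom`/`pointIdeal`: the maximal ideal `𝔮 = (X₀, X₁^p − t)` of `K[X₀,X₁]` (kernel of
  `X₀ ↦ 0, X₁ ↦ t^{1/p}` onto `K[X]/(X^p − t)`), `pointIdeal_le_span` (`𝔮 = (X₀, X₁^p − t)`),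
  `pointIdeal_isMaximal` (when `X^p − t` is irreducible, i.e. `t ∉ K^p`).
* §3 `QIdeal K p t q N = 𝔮/(f_N)` (the point `P_N`), maximal; `QIdeal_one_eq_span`: for `N = 1` it is
  generated by `y` ("the maximal ideal of this point … is generated by `y` alone", Kollár 2007, 1.19);
  `valuationRing_cond_localization_QIdeal_one`: `(A_1)_{Q}` is a valuation ring (a Noetherian local domain
  with principal maximal ideal; Mathlib `tfae_of_isNoetherianRing_of_isLocalRing_of_isDomain`).

HONEST FRAMING. OURS bookkeeping towards an OURS negative rung; NOT a statement of H. Hironaka's 2017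
manuscript (*Resolution of singularities in positive characteristics*, [Hironaka2017]); nothing here is
attributed to its author. Elementary commutative algebra; AI work, weaker than expert review.

## References (vocabulary and locators only)
* J. Kollár, *Lectures on Resolution of Singularities* (2007), 1.19 (the curve `y² = x^p − t`). [Kollar2007]
* J. Tate, *Genus change in inseparable extensions of function fields*, Proc. AMS 3 (1952) — the phenomenon
  behind the unbounded exponent (not used formally); Cruxes/PrimeFieldToPerfect/KERNEL-c3.md §1 (1c).
-/

noncomputable section

set_option linter.dupNamespace false -- mandated namespace of this single-conjunct summit

open Polynomial

namespace Summit.ResolutionOfSingularities.ResolutionOfSingularities.Theorems.CampaignW82.TwistExponent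

/-! ## §0 Binomials `Y^q − a` over a unique factorisation domain -/

/-- In a domain, `totalDegree (u ^ n) = n * totalDegree u` for `u ≠ 0`. [folklore] -/
theorem totalDegree_pow_of_ne_zero {R : Type*} [CommRing R] [IsDomain R] {σ : Type*}
    {u : MvPolynomial σ R} (hu : u ≠ 0) (n : ℕ) : (u ^ n).totalDegree = n * u.totalDegree := by
  induction n with
  | zero => simp
  | succ n ih =>
    rw [pow_succ, MvPolynomial.totalDegree_mul_of_isDomain (pow_ne_zero n hu) hu, ih]
    ring

/-- **Gauss + Kummer**: over a unique factorisation domain `R`, for a prime `q` and `a ∈ R` which is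
not a `q`-th power in `Frac R`, the binomial `Y^q − a ∈ R[Y]` is prime. [folklore] -/
theorem prime_X_pow_sub_C {R : Type*} [CommRing R] [IsDomain R] [UniqueFactorizationMonoid R]
    {q : ℕ} (hq : q.Prime) (a : R)
    (h : ∀ c : FractionRing R, c ^ q ≠ algebraMap R (FractionRing R) a) :
    Prime (X ^ q - C a : R[X]) := by
  have hmonic : (X ^ q - C a : R[X]).Monic := monic_X_pow_sub_C a hq.ne_zero
  have hirr : Irreducible ((X ^ q - C a : R[X]).map (algebraMap R (FractionRing R))) := by
    rw [Polynomial.map_sub, Polynomial.map_pow, map_X, map_C]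
    exact (X_pow_sub_C_irreducible_iff_of_prime hq).mpr h
  exact UniqueFactorizationMonoid.irreducible_iff_prime.mp
    ((hmonic.irreducible_iff_irreducible_map_fraction_map).mpr hirr)

/-- A nonzero polynomial whose total degree is not divisible by the prime `q` is not a `q`-th
power in the fraction field (degree count). [folklore] -/
theorem forall_pow_ne_of_not_dvd_totalDegree {K : Type*} [Field K] {σ : Type*} {q : ℕ}
    (hq : q.Prime) (a : MvPolynomial σ K) (ha : a ≠ 0) (hqa : ¬ q ∣ a.totalDegree) :
    ∀ c : FractionRing (MvPolynomial σ K),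
      c ^ q ≠ algebraMap (MvPolynomial σ K) (FractionRing (MvPolynomial σ K)) a := by
  intro c hc
  obtain ⟨u, v, hv, rfl⟩ := IsFractionRing.div_surjective (A := MvPolynomial σ K) c
  have hv0 : v ≠ 0 := nonZeroDivisors.ne_zero hv
  rw [div_pow, div_eq_iff (pow_ne_zero _ (IsFractionRing.to_map_ne_zero_of_mem_nonZeroDivisors hv)),
    ← map_pow, ← map_pow, ← map_mul] at hc
  have huv : u ^ q = a * v ^ q := IsFractionRing.injective (MvPolynomial σ K) _ hc
  have hu0 : u ≠ 0 := by
    rintro rfl; rw [zero_pow hq.ne_zero] at huv; exact mul_ne_zero ha (pow_ne_zero _ hv0) huv.symm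
  have hdeg := congrArg MvPolynomial.totalDegree huv
  rw [totalDegree_pow_of_ne_zero hu0, MvPolynomial.totalDegree_mul_of_isDomain ha (pow_ne_zero _ hv0),
    totalDegree_pow_of_ne_zero hv0] at hdeg
  exact hqa ⟨u.totalDegree - v.totalDegree, by rw [Nat.mul_sub]; omega⟩

/-! ## §1 The curves `f_N = Y^q − (X^p − t)^N` -/

section Curves

variable (K : Type) [Field K] (p : ℕ) (t : K) (q : ℕ)

/-- `g = X₁^p − t ∈ K[X₀, X₁]` (the inseparable factor; `X₁ = x`, `X₀ = y`). [folklore] -/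
def gPoly : MvPolynomial (Fin 2) K := MvPolynomial.X 1 ^ p - MvPolynomial.C t

/-- `f_N = X₀^q − (X₁^p − t)^N ∈ K[X₀, X₁]`: for `N = p^e` the `e`-th Frobenius twist of
`y^q = x^{p^{e+1}} − t`; for `N = 1` Kollár's curve `y^q = x^p − t`. [folklore] -/
def twistPoly (N : ℕ) : MvPolynomial (Fin 2) K :=
  MvPolynomial.X 0 ^ q - (MvPolynomial.X 1 ^ p - MvPolynomial.C t) ^ N

/-- The coordinate ring `A_N = K[X₀, X₁]/(f_N)`. [folklore] -/
abbrev TwistRing (N : ℕ) : Type := MvPolynomial (Fin 2) K ⧸ Ideal.span {twistPoly K p t q N}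

/-- Under `K[X₀,X₁] ≅ K[X₁][X₀]`, `f_N ↦ X₀^q − C((X₁^p − t)^N)`. [folklore] -/
theorem finSuccEquiv_twistPoly (N : ℕ) :
    MvPolynomial.finSuccEquiv K 1 (twistPoly K p t q N) =
      X ^ q - C ((MvPolynomial.X 0 ^ p - MvPolynomial.C t) ^ N) := by
  have h1 : MvPolynomial.finSuccEquiv K 1 (MvPolynomial.X 1) = C (MvPolynomial.X 0) :=
    MvPolynomial.finSuccEquiv_X_succ (j := 0)
  have h2 : MvPolynomial.finSuccEquiv K 1 (MvPolynomial.C t) = C (MvPolynomial.C t) := by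
    rw [MvPolynomial.finSuccEquiv_apply]; simp
  simp [twistPoly, MvPolynomial.finSuccEquiv_X_zero, h1, h2]

/-- The total degree of `(X₀^p − t)^N ∈ K[X₀]` is `N p`. [folklore] -/
theorem totalDegree_base_pow [hp : Fact p.Prime] (N : ℕ) :
    ((MvPolynomial.X (0 : Fin 1) ^ p - MvPolynomial.C t : MvPolynomial (Fin 1) K) ^ N).totalDegree
      = N * p := by
  have hp0 : 0 < p := hp.out.pos
  have hdeg : (MvPolynomial.X (0 : Fin 1) ^ p - MvPolynomial.C t : MvPolynomial (Fin 1) K).totalDegree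
      = p := by
    rw [sub_eq_add_neg, ← map_neg, MvPolynomial.totalDegree_add_eq_left_of_totalDegree_lt]
    · exact MvPolynomial.totalDegree_X_pow _ _
    · rw [MvPolynomial.totalDegree_C, MvPolynomial.totalDegree_X_pow]; exact hp0
  have hne : (MvPolynomial.X (0 : Fin 1) ^ p - MvPolynomial.C t : MvPolynomial (Fin 1) K) ≠ 0 := by
    intro h
    have := congrArg MvPolynomial.totalDegree h
    rw [hdeg, MvPolynomial.totalDegree_zero] at this
    omega
  rw [totalDegree_pow_of_ne_zero hne, hdeg]

variable {K p t q}

/-- **`f_N` is prime** (`q ≠ p` prime, `q ∤ N`): `Y^q − a` with `a = (X^p − t)^N` of degree `Np`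
not divisible by `q`. [folklore] -/
theorem prime_twistPoly [hp : Fact p.Prime] [hq : Fact q.Prime] (hqp : q ≠ p) {N : ℕ} (hqN : ¬ q ∣ N) :
    Prime (twistPoly K p t q N) := by
  have hq' : q.Prime := hq.out
  let a : MvPolynomial (Fin 1) K := (MvPolynomial.X 0 ^ p - MvPolynomial.C t) ^ N
  have ha : a ≠ 0 := by
    intro h
    have := congrArg MvPolynomial.totalDegree h
    rw [totalDegree_base_pow, MvPolynomial.totalDegree_zero] at this
    rcases Nat.mul_eq_zero.mp this with h0 | h0; exacts [hqN (h0 ▸ dvd_zero q), hp.out.ne_zero h0]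
  have hqa : ¬ q ∣ a.totalDegree := by
    rw [totalDegree_base_pow]; intro h
    rcases (Nat.Prime.dvd_mul hq').mp h with h1 | h1
    · exact hqN h1
    · exact hqp ((Nat.prime_dvd_prime_iff_eq hq' hp.out).mp h1)
  have hprime : Prime (X ^ q - C a : (MvPolynomial (Fin 1) K)[X]) :=
    prime_X_pow_sub_C hq' a (forall_pow_ne_of_not_dvd_totalDegree hq' a ha hqa)
  refine (MulEquiv.prime_iff (MvPolynomial.finSuccEquiv K 1)).mp ?_
  rw [finSuccEquiv_twistPoly]
  exact hprime

/-- `f_N ≠ 0`. [folklore] -/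
theorem twistPoly_ne_zero [Fact p.Prime] [Fact q.Prime] (hqp : q ≠ p) {N : ℕ} (hqN : ¬ q ∣ N) :
    twistPoly K p t q N ≠ 0 :=
  (prime_twistPoly hqp hqN).ne_zero

/-- `(f_N)` is a prime ideal. [folklore] -/
theorem isPrime_span_twistPoly [Fact p.Prime] [Fact q.Prime] (hqp : q ≠ p) {N : ℕ} (hqN : ¬ q ∣ N) :
    (Ideal.span {twistPoly K p t q N}).IsPrime :=
  (Ideal.span_singleton_prime (twistPoly_ne_zero hqp hqN)).mpr (prime_twistPoly hqp hqN)

/-- **`A_N = K[X₀,X₁]/(f_N)` is a domain** (`q ≠ p` prime, `q ∤ N`). [folklore] -/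
theorem isDomain_twistRing [Fact p.Prime] [Fact q.Prime] (hqp : q ≠ p) {N : ℕ} (hqN : ¬ q ∣ N) :
    IsDomain (TwistRing K p t q N) :=
  (Ideal.Quotient.isDomain_iff_prime _).mpr (isPrime_span_twistPoly hqp hqN)

/-! ## §2 The point `P_N = (X₀, X₁^p − t)` of `A_N` -/

variable (K p t q)

/-- Evaluation at the point `(0, t^{1/p})`: `K[X₀,X₁] → K[X]/(X^p − t)`, `X₀ ↦ 0`, `X₁ ↦ X̄`.
[folklore] -/
def pointHom : MvPolynomial (Fin 2) K →ₐ[K] AdjoinRoot (X ^ p - C t : K[X]) :=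
  MvPolynomial.aeval ![0, AdjoinRoot.root (X ^ p - C t : K[X])]

/-- The ideal `𝔮 = ker (X₀ ↦ 0, X₁ ↦ t^{1/p}) ⊂ K[X₀,X₁]` of the point `(0, t^{1/p})`. [folklore] -/
def pointIdeal : Ideal (MvPolynomial (Fin 2) K) := RingHom.ker (pointHom K p t)

/-- `X₀ ↦ 0`. [folklore] -/
theorem pointHom_X_zero : pointHom K p t (MvPolynomial.X 0) = 0 := by simp [pointHom]

/-- `X₁ ↦ t^{1/p}`. [folklore] -/
theorem pointHom_X_one : pointHom K p t (MvPolynomial.X 1) = AdjoinRoot.root (X ^ p - C t : K[X]) := by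
  simp [pointHom]
/-- `pointHom` is surjective (`X₁ ↦` the generator). [folklore] -/
theorem pointHom_surjective : Function.Surjective (pointHom K p t) := by
  intro z
  induction z using AdjoinRoot.induction_on with
  | ih g =>
    refine ⟨Polynomial.aeval (MvPolynomial.X 1) g, ?_⟩
    rw [← Polynomial.aeval_algHom_apply, pointHom_X_one, AdjoinRoot.aeval_eq]

/-- `g = X₁^p − t` lies in `𝔮`. [folklore] -/
theorem gPoly_mem_pointIdeal : gPoly K p t ∈ pointIdeal K p t := by
  rw [pointIdeal, RingHom.mem_ker]
  have h : pointHom K p t (gPoly K p t) = Polynomial.aeval (AdjoinRoot.root (X ^ p - C t : K[X]))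
      (X ^ p - C t : K[X]) := by
    simp [gPoly, pointHom_X_one]
  rw [h, AdjoinRoot.aeval_eq, AdjoinRoot.mk_self]

/-- `X₀ ∈ 𝔮`. [folklore] -/
theorem X_zero_mem_pointIdeal : (MvPolynomial.X 0 : MvPolynomial (Fin 2) K) ∈ pointIdeal K p t := by
  rw [pointIdeal, RingHom.mem_ker, pointHom_X_zero]
/-- `f_N ∈ 𝔮` for `N ≥ 1` and `q ≥ 1`. [folklore] -/
theorem twistPoly_mem_pointIdeal [hq : Fact q.Prime] {N : ℕ} (hN : 0 < N) :
    twistPoly K p t q N ∈ pointIdeal K p t := by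
  have h1 : MvPolynomial.X 0 ^ q ∈ pointIdeal K p t :=
    Ideal.pow_mem_of_mem _ (X_zero_mem_pointIdeal K p t) q hq.out.pos
  have h2 : (MvPolynomial.X 1 ^ p - MvPolynomial.C t) ^ N ∈ pointIdeal K p t :=
    Ideal.pow_mem_of_mem _ (gPoly_mem_pointIdeal K p t) N hN
  exact Ideal.sub_mem _ h1 h2

/-- `𝔮` is a maximal ideal when `X^p − t` is irreducible (`K[X]/(X^p − t)` is then a field).
[folklore] -/
theorem pointIdeal_isMaximal (ht : Irreducible (X ^ p - C t : K[X])) : (pointIdeal K p t).IsMaximal := by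
  haveI := Fact.mk ht
  exact RingHom.ker_isMaximal_of_surjective (pointHom K p t) (pointHom_surjective K p t)

/-- Substituting `X₀ := 0`. [folklore] -/
def killY : MvPolynomial (Fin 2) K →ₐ[K] MvPolynomial (Fin 2) K :=
  MvPolynomial.aeval ![0, MvPolynomial.X 1]

/-- `h − h(0, X₁) ∈ (X₀)`. [folklore] -/
theorem sub_killY_mem_span (h : MvPolynomial (Fin 2) K) :
    h - killY K h ∈ Ideal.span {(MvPolynomial.X 0 : MvPolynomial (Fin 2) K)} := by
  induction h using MvPolynomial.induction_on with
  | C a => simp [killY]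
  | add a b ha hb =>
    have : a + b - killY K (a + b) = (a - killY K a) + (b - killY K b) := by rw [map_add]; ring
    rw [this]; exact Ideal.add_mem _ ha hb
  | mul_X h i ih =>
    have hi : i = 0 ∨ i = 1 := by
      rcases i with ⟨_ | i, hi⟩
      · exact Or.inl rfl
      · right; ext; simp; omega
    rcases hi with rfl | rfl
    · rw [show h * MvPolynomial.X 0 - killY K (h * MvPolynomial.X 0) = MvPolynomial.X 0 * h by
        simp [killY]; ring]
      exact Ideal.mul_mem_right _ _ (Ideal.subset_span rfl)
    · have : h * MvPolynomial.X 1 - killY K (h * MvPolynomial.X 1) =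
          (h - killY K h) * MvPolynomial.X 1 := by
        simp [killY]; ring
      rw [this]; exact Ideal.mul_mem_right _ _ ih

/-- `killY` factors through `K[X]`: `h(0, X₁) = ι(h(0, X))` with `ι : K[X] → K[X₀,X₁]`, `X ↦ X₁`.
[folklore] -/
theorem killY_eq_aeval_aeval (h : MvPolynomial (Fin 2) K) :
    killY K h = Polynomial.aeval (MvPolynomial.X 1 : MvPolynomial (Fin 2) K)
      (MvPolynomial.aeval ![(0 : K[X]), X] h) := by
  change killY K h = ((Polynomial.aeval (MvPolynomial.X 1 : MvPolynomial (Fin 2) K)).comp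
    (MvPolynomial.aeval ![(0 : K[X]), X])) h
  rw [MvPolynomial.comp_aeval, killY]
  congr 1
  ext i : 1
  fin_cases i <;> simp

/-- `pointHom = (K[X] → K[X]/(X^p − t)) ∘ (X₀ ↦ 0, X₁ ↦ X)`. [folklore] -/
theorem pointHom_eq_mk_aeval (h : MvPolynomial (Fin 2) K) :
    pointHom K p t h = AdjoinRoot.mk (X ^ p - C t : K[X]) (MvPolynomial.aeval ![(0 : K[X]), X] h) := by
  have key : (pointHom K p t : MvPolynomial (Fin 2) K →+* AdjoinRoot (X ^ p - C t : K[X])) =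
      (AdjoinRoot.mk (X ^ p - C t : K[X])).comp
        (MvPolynomial.aeval ![(0 : K[X]), X] : MvPolynomial (Fin 2) K →ₐ[K] K[X]) := by
    refine MvPolynomial.ringHom_ext (fun a => ?_) (fun i => ?_)
    · simp [pointHom, AdjoinRoot.algebraMap_eq]
    · fin_cases i <;> simp [pointHom]
  exact congrArg (fun φ : MvPolynomial (Fin 2) K →+* AdjoinRoot (X ^ p - C t : K[X]) => φ h) key

/-- **`𝔮 = (X₀, X₁^p − t)`** (the inclusion `≤`; the reverse is `X_zero_mem_pointIdeal`,
`gPoly_mem_pointIdeal`). [folklore] -/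
theorem pointIdeal_le_span :
    pointIdeal K p t ≤ Ideal.span {(MvPolynomial.X 0 : MvPolynomial (Fin 2) K), gPoly K p t} := by
  intro h hh
  rw [pointIdeal, RingHom.mem_ker, pointHom_eq_mk_aeval, AdjoinRoot.mk_eq_zero] at hh
  obtain ⟨k, hk⟩ := hh
  have hkill : killY K h = gPoly K p t * Polynomial.aeval (MvPolynomial.X 1 : MvPolynomial (Fin 2) K) k := by
    rw [killY_eq_aeval_aeval, hk, map_mul]
    congr 1
    simp [gPoly]
  rw [show h = (h - killY K h) + killY K h by ring]
  refine Ideal.add_mem _ ?_ ?_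
  · exact Ideal.span_mono (Set.singleton_subset_iff.mpr (Set.mem_insert _ _)) (sub_killY_mem_span K h)
  · rw [hkill]
    exact Ideal.mul_mem_right _ _ (Ideal.subset_span (by simp))

/-! ## §3 The image `Q_N` of `𝔮` in `A_N`; for `N = 1` it is principal and `(A_1)_{Q}` is a DVR -/

/-- The prime `Q_N = 𝔮/(f_N) ⊂ A_N` — the point `P_N = (y = 0, x^p = t)` of the curve
`y^q = (x^p − t)^N`. [folklore] -/
def QIdeal (N : ℕ) : Ideal (TwistRing K p t q N) :=
  (pointIdeal K p t).map (Ideal.Quotient.mk (Ideal.span {twistPoly K p t q N}))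

/-- The class `y = X̄₀ ∈ A_N`. [folklore] -/
def yElt (N : ℕ) : TwistRing K p t q N := Ideal.Quotient.mk _ (MvPolynomial.X 0)

/-- The class `ḡ ∈ A_N` of `X₁^p − t`. [folklore] -/
def gElt (N : ℕ) : TwistRing K p t q N := Ideal.Quotient.mk _ (gPoly K p t)
/-- The defining relation `y^q = ḡ^N` in `A_N`. [folklore] -/
theorem yElt_pow_eq (N : ℕ) : yElt K p t q N ^ q = gElt K p t q N ^ N := by
  rw [yElt, gElt, ← map_pow, ← map_pow, ← sub_eq_zero, ← map_sub, Ideal.Quotient.eq_zero_iff_mem]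
  exact Ideal.subset_span rfl

/-- The preimage of `Q_N` in `K[X₀,X₁]` is `𝔮` (`N ≥ 1`). [folklore] -/
theorem comap_QIdeal [Fact q.Prime] {N : ℕ} (hN : 0 < N) :
    (QIdeal K p t q N).comap (Ideal.Quotient.mk _) = pointIdeal K p t := by
  rw [QIdeal, Ideal.comap_map_of_surjective _ Ideal.Quotient.mk_surjective, ← RingHom.ker_eq_comap_bot,
    Ideal.mk_ker, sup_eq_left]
  exact (Ideal.span_singleton_le_iff_mem _).mpr (twistPoly_mem_pointIdeal K p t q hN)

/-- `Q_N` is maximal (`X^p − t` irreducible, `N ≥ 1`). [folklore] -/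
theorem QIdeal_isMaximal [Fact q.Prime] (ht : Irreducible (X ^ p - C t : K[X])) {N : ℕ} (hN : 0 < N) :
    (QIdeal K p t q N).IsMaximal := by
  rcases Ideal.map_eq_top_or_isMaximal_of_surjective (Ideal.Quotient.mk (Ideal.span {twistPoly K p t q N}))
    Ideal.Quotient.mk_surjective (pointIdeal_isMaximal K p t ht) with h | h
  · exfalso
    have := comap_QIdeal K p t q hN
    have h' : QIdeal K p t q N = ⊤ := h
    rw [h', Ideal.comap_top] at this
    exact (pointIdeal_isMaximal K p t ht).ne_top this.symm
  · exact h

/-- `Q_N` is prime. [folklore] -/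
theorem QIdeal_isPrime [Fact q.Prime] (ht : Irreducible (X ^ p - C t : K[X])) {N : ℕ} (hN : 0 < N) :
    (QIdeal K p t q N).IsPrime :=
  (QIdeal_isMaximal K p t q ht hN).isPrime

/-- `y ∈ Q_N`. [folklore] -/
theorem yElt_mem_QIdeal (N : ℕ) : yElt K p t q N ∈ QIdeal K p t q N :=
  Ideal.mem_map_of_mem _ (X_zero_mem_pointIdeal K p t)

/-- **For `N = 1` the point ideal is principal: `Q_1 = (y)`** — since `ḡ = y^q` in
`A_1 = K[x,y]/(y^q − g)`, "the maximal ideal of this point … is generated by `y` alone"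
(Kollár 2007, 1.19). [folklore] -/
theorem QIdeal_one_eq_span [hq : Fact q.Prime] : QIdeal K p t q 1 = Ideal.span {yElt K p t q 1} := by
  have hg : gElt K p t q 1 ∈ Ideal.span {yElt K p t q 1} := by
    rw [(pow_one (gElt K p t q 1)).symm.trans (yElt_pow_eq K p t q 1).symm]
    exact Ideal.pow_mem_of_mem _ (Ideal.subset_span (Set.mem_singleton _)) _ hq.out.pos
  apply le_antisymm
  · have h1 : QIdeal K p t q 1 ≤ (Ideal.span {(MvPolynomial.X 0 : MvPolynomial (Fin 2) K), gPoly K p t}).map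
        (Ideal.Quotient.mk (Ideal.span {twistPoly K p t q 1})) :=
      Ideal.map_mono (pointIdeal_le_span K p t)
    refine h1.trans ?_
    rw [Ideal.map_span, Set.image_insert_eq, Set.image_singleton, Ideal.span_le]
    intro x hx
    rcases hx with rfl | rfl
    · exact Ideal.subset_span (Set.mem_singleton _)
    · exact hg
  · rw [Ideal.span_le, Set.singleton_subset_iff]
    exact yElt_mem_QIdeal K p t q 1

/-- **`(A_1)_{Q}` is a valuation ring (indeed a DVR)**: a Noetherian local domain whose maximal
ideal is principal; stated as the divisibility dichotomy `a ∣ b ∨ b ∣ a` (Mathlib's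
`PreValuationRing` condition) so that no instance appears in the statement. [folklore] -/
theorem valuationRing_cond_localization_QIdeal_one [Fact p.Prime] [hq : Fact q.Prime] (hqp : q ≠ p)
    (ht : Irreducible (X ^ p - C t : K[X])) :
    haveI := QIdeal_isPrime K p t q ht Nat.one_pos
    ∀ a b : Localization.AtPrime (QIdeal K p t q 1), ∃ c, a * c = b ∨ b * c = a := by
  haveI hQ := QIdeal_isPrime K p t q ht Nat.one_pos
  haveI : IsDomain (TwistRing K p t q 1) := isDomain_twistRing hqp (by
    intro h; exact hq.out.ne_one (Nat.dvd_one.mp h))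
  haveI : IsNoetherianRing (Localization.AtPrime (QIdeal K p t q 1)) := inferInstance
  have hmap : Ideal.map (algebraMap (TwistRing K p t q 1) (Localization.AtPrime (QIdeal K p t q 1)))
      (QIdeal K p t q 1) =
      Ideal.span {algebraMap _ (Localization.AtPrime (QIdeal K p t q 1)) (yElt K p t q 1)} := by
    have h := congrArg
      (Ideal.map (algebraMap (TwistRing K p t q 1) (Localization.AtPrime (QIdeal K p t q 1))))
      (QIdeal_one_eq_span K p t q)
    rw [h, Ideal.map_span, Set.image_singleton]
  have hprinc : (IsLocalRing.maximalIdeal (Localization.AtPrime (QIdeal K p t q 1))).IsPrincipal := by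
    rw [← Localization.AtPrime.map_eq_maximalIdeal, hmap]
    exact ⟨⟨_, rfl⟩⟩
  have hv : ValuationRing (Localization.AtPrime (QIdeal K p t q 1)) :=
    ((tfae_of_isNoetherianRing_of_isLocalRing_of_isDomain
      (Localization.AtPrime (QIdeal K p t q 1))).out 4 1).mp hprinc
  exact hv.toPreValuationRing.cond'

end Curves

end Summit.ResolutionOfSingularities.ResolutionOfSingularities.Theorems.CampaignW82.TwistExponent

end
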